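import Literature.MathematicalPhysics.QuantumFieldTheory.Balaban1983to89.B9Eq3132FromStateR
import Literature.MathematicalPhysics.QuantumFieldTheory.Balaban1983to89.B1Eq324BenfattoClassSectEMemberPrecisionDoorRecordV4PAdjCurrentCancelLeaf
import Literature.MathematicalPhysics.QuantumFieldTheory.Balaban1983to89.B9BackgroundsKLevelV1Pb

/-!
# `Balaban1983to89.B9Eq342G1FamilySocketFromStateR` — T. Bałaban, *Propagators for lattice gauge theories in a background field*, Commun. Math. Phys. **99** (1985)
# 389–434 [Balaban1985BackgroundPropagators], Theorem 3.12 p. 423 with (3.42) p. 397: THE (3.42)₁ SUP-ENTRY FAMILY OF `G₁` AT PRINT'S CLASS — THE N06 → N08 SOCKET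
# BY NAME (node N06's state-tuple producer `B9Eq3132FromStateR.majorants4_of_stepS_R` ⟹ the `hG1fam` binder of node N08's (3.24) door
# `B1Eq324BenfattoClassSectEMemberPrecisionDoorRecordV4PAdjCurrentCancelLeaf`)

[4] = T. Bałaban, *Propagators and renormalization transformations for lattice gauge theories. II*, Commun. Math. Phys. **96** (1984) 223–250 [`Balaban1984PropagatorsII`].

statement-level skeleton of published theorems with citation tags; proofs where landed; nothing here is a claim about the Yang–Mills mass gap

THE PRINT.  [B9] Thm 3.12 p. 423: *«Theorems 3.3, 3.10, 3.11 hold for G, G₁ with one exception … the inequality in (3.42) involving the covariant Laplace operator»* —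
in particular the (3.42)₁ sup entry p. 397 *«|G(U; x, x′)| ≦ O(1)(Lʲη)² exp(−δ d(x, x′))»* for `G₁ = Σₙ G₀(TG₀)ⁿ` ((3.130) p. 421, (3.138) p. 423), under the prefix
*«If an external gauge field configuration U satisfies both regularity conditions (3.35), (3.36) for α₀ sufficiently small»* (p. 396).  [4] (2.51) p. 232 is the
blockwise majorant currency `|A(a, b)| ≦ K(a, b)` in which the tree states it (`B6RandomWalk.HasMajorant`).

WHY THIS FILE (cell `pub-ymgap`, HUMAN RULING D-0062, Track A; node N08 [B10] seat `pub-ymgap-dag-n08-d` gen 46, 2026-08-29).  Node N08's (3.24) socket door of record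
(`…PrecisionDoorRecordV4PAdjCurrentCancelLeaf`, two ★★★★★ theorems) displays node N06's Theorem 3.12 input for `G₁` as ONE binder `hG1fam` in MODEL currency:
`∃ M₂ a₂ C_G δ_G, … ∀ x, M₂ ≤ M → ∀ α₀ > 0, Mα₀ ≤ a₂ → ∀ U ∈ (3.35)–(3.36) at print's class, HasMajorant (blkBK (bI x)) (GcoK … (G1Y … (GpPhysY …) (𝔯 x).Δ2) U) (C_G·(Lʲη)_a²·e^{−δ_G d})`.
Node N06 (seat dag-n06-d g18, 2026-08-29) landed the producer of exactly that family from its REGULAR-STATE tuple at the pins of the class-parametric carrier: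
`B9Eq3132FromStateR.majorants4_of_stepS_R` (four [4]-(2.51) majorant families for the letters `T`, `T₁`, `T − T₀`, `T₁ − T₀`; hypothesis `hstate` = the state tuple
its certificate edition feeds row 26 with).  The two statements differ only by BOOKKEEPING: the producer is typed over `bg9YR 𝔸 G R₁ R₂ x` and packages the rate as a
parameter and the four families as a conjunction; the door is typed with `bg9Y` inside `Cfg`∕`GcoK` and `bg9YP` in `Reg335∕Reg336`, one family, the rate existential.
THIS FILE is the socket adapter BY NAME, so that the junction's call into the door's `hG1fam` slot — and node N06's export of it — is ONE line.

WHAT IS PROVED (sorry-free, 0 `def`, no estimate — projections and `rfl`-level class bookkeeping only).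
* §1 `hG1fam_of_majorants_R` — SHAPE LEVEL: the `∃ M₂ a₂ C δ, … (T-family) ∧ (T₁-family)` package (the conclusion type of
  `B9Eq3132DecayFromMajorantR.majorants_of_step12_R`) read at print's class `(R₁, R₂) := (regYP335 𝔸 G, regYP336 𝔸 G)` ⟹ the door's `hG1fam` shape for `T₁`
  (generic `𝔸 G κ bK c35 H₀ T₁ bI`).  Why it type-checks: `bg9YR 𝔸 G (regYP335 𝔸 G) (regYP336 𝔸 G) x = bg9YP 𝔸 G x` (`B9BackgroundsKLevelV1R.bg9YP_eq_bg9YR`, `rfl`)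
  and `GcoK b B cfg O U₁ := cR39 b • coordOpK b (fun _ => (O (cfg U₁)).restrictScalars ℝ)` reads the `Backgrounds` argument through `B.Cfg` only
  (`B9BackgroundsKLevelV1P.bg9YP_Cfg_eq`, `rfl`), so `GcoK … (bg9YP x) …` and `GcoK … (bg9Y x) …` are definitionally one operator.
* §2 ★★ `hG1fam_of_majorants4_of_stepS_R` — BY NAME: the hypotheses of `majorants4_of_stepS_R` verbatim at print's class ⟹ the door's `hG1fam` shape for `T₁`
  (one call, projection `.2.1`, the rate witness `δ_G := δ`).
* §3 ★★ `hG1fam_lettersYOfRecordV4P_of_majorants4_of_stepS_R` — §2 AT THE RECORD (`𝔸 := Matrix (Fin N) (Fin N) ℂ`, `G := specialUnitaryUnits (Fin N)`,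
  `bK := trBasis N`, `c35 := c35Y`, `T₁ x := G1Y x.toKIdx (parSymY …) (parBY …) (GpPhysY …) (𝔯 x).Δ2`, `H₀ := Hg`): the conclusion is the door's `hG1fam` binder
  character for character.

HONEST SCOPE.  Plumbing between two LANDED statements of nodes N06 and N08; nothing of [B9] ∕ [4] is asserted (Theorem 3.12's content stays in node N06's displayed
state tuple `hstate`); no door text is copied, no definition, no estimate; COUNT-NEUTRAL; the identification `h324c` is NOT made; N06 ∕ N08 NOT discharged; K1⁹ NOT
closed; one finite 𝕋^{d+1} programme at fixed ε — nothing continuum, nothing OS, nothing about the mass gap.  NEW file; nothing landed is modified.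
RELATED, NOT DUPLICATED: `B9Eq3132FromStateR.hdec26_of_stepS_of_R` (row 26's decay binders from the same tuple — the `T`∕`T₁` projections feed `DecayUnder`, not a door);
`B9Thm312WholeEntry0Regular.entry0_of_stepS_resolvent` (dag-n06-l: the one-member engine behind the same entry); `B9Eq3132DecayFromMajorantR.majorants_of_step12_R`
(the raw-step producer of the same shape, U8 species — §1 reads its conclusion TYPE only, as a hypothesis).
-/

noncomputable section

namespace Literature.MathematicalPhysics.QuantumFieldTheory.Balaban1983to89.B9Eq342G1FamilySocketFromStateR

open B6RandomWalk (HasMajorant)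
open B11SectG (HasMaj BlockNorm)
open B9Thm312Whole (Ops Identities GeoOK cNorm)
open B9Thm312WholeClasses (cNormR)
open B9Thm312WholeStepRegular (StepS)
open B9CoReadingCoords (XBK blkBK GcoK)
open B9CoReadingCoordsTranspose (TrIdx trBasis)
open Node00 (IBondY FBondY CfgY BondOpY parSymY parBY GpPhysY G1Y ResY Stage3Params)
open B9Thm34Ext (toB6)
open B9PinMembersKLevelV1 (MemberY geo9Y bg9Y)
open B9BackgroundsKLevelV1R (RegFamY bg9YR regYP335 regYP336)
open B9BackgroundsKLevelV1P (bg9YP)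
open B9PinGeometryKLevelV1 (c35Y)
open B7Prop2SpecialUnitary (specialUnitaryUnits)
open B9Eq3132FromStateR (majorants4_of_stepS_R)
open scoped Matrix.Norms.L2Operator

/-! ## §1 Shape level: the producer's `∃ … ∧ …` package at print's class ⟹ the door's `hG1fam` shape -/

section Shape

variable {𝔸 : Type} [NormedRing 𝔸] [NormedAlgebra ℂ 𝔸]
variable {κ : Type} [Fintype κ]
variable {d ℓ : ℕ} {hd : 1 ≤ d + 1} {hL : Odd (ℓ + 1) ∧ 1 < ℓ + 1} {b₀ b₁ : ℝ} {Mstar : ℕ}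
variable [CompleteSpace 𝔸] [FiniteDimensional ℝ 𝔸] {G : Subgroup 𝔸ˣ}

/-- **THE SOCKET AT SHAPE LEVEL**: the `∃ M₂ a₂ C δ, 0 < M₂ ∧ 0 < a₂ ∧ 0 ≤ C ∧ 0 < δ ∧ ∀ …, (T-family) ∧ (T₁-family)` package of [4]-(2.51) majorants of the
coordinate models over the class-parametric carrier READ AT PRINT'S CLASS `(regYP335, regYP336)` (the conclusion type of
`B9Eq3132DecayFromMajorantR.majorants_of_step12_R` there) gives the `T₁`-family in the door's typing (`bg9Y` inside `Cfg`∕`GcoK`, `bg9YP` in `Reg335`∕`Reg336`) —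
by the projection `.2`; `bg9YR … (regYP335 …) (regYP336 …) x = bg9YP … x` and `(bg9YP … x).Cfg = (bg9Y … x).Cfg` hold by `rfl`, and `GcoK` reads its `Backgrounds`
argument through `.Cfg` only.
[cite: Balaban1985BackgroundPropagators, Thm 3.12 p.423, (3.42) p.397, (3.35)–(3.36) p.396; Balaban1984PropagatorsII, (2.51) p.232 (bookkeeping)] -/
theorem hG1fam_of_majorants_R [∀ x : MemberY d ℓ hd hL b₀ b₁ Mstar, Fintype (geo9Y x).Site] (bK : Module.Basis κ ℝ 𝔸) (c35 : ℝ)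
    (H₀ : MemberY d ℓ hd hL b₀ b₁ Mstar → Prop) (T T₁ : ∀ x : MemberY d ℓ hd hL b₀ b₁ Mstar, BondOpY 𝔸 x.toKIdx)
    (bI : ∀ x : MemberY d ℓ hd hL b₀ b₁ Mstar, FBondY x.toKIdx → IBondY x.toKIdx)
    (h : ∃ M₂ a₂ C δ : ℝ, 0 < M₂ ∧ 0 < a₂ ∧ 0 ≤ C ∧ 0 < δ ∧
      ∀ x : MemberY d ℓ hd hL b₀ b₁ Mstar, M₂ ≤ (geo9Y x).M → ∀ α₀ : ℝ, 0 < α₀ → (geo9Y x).M * α₀ ≤ a₂ →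
        ∀ U : (bg9YR 𝔸 G (regYP335 𝔸 G) (regYP336 𝔸 G) x).Cfg,
          (bg9YR 𝔸 G (regYP335 𝔸 G) (regYP336 𝔸 G) x).Reg335 c35 α₀ U →
          (bg9YR 𝔸 G (regYP335 𝔸 G) (regYP336 𝔸 G) x).Reg336 c35 α₀ U →
          HasMajorant (g := toB6 (geo9Y x) 1 (H₀ x)) (blkBK x.toKIdx (bI x))
              (GcoK x.toKIdx bK (bg9YR 𝔸 G (regYP335 𝔸 G) (regYP336 𝔸 G) x) (fun U => U) (T x) U)
              (fun a a' => C * (geo9Y x).len a ^ 2 * Real.exp (-(δ * (geo9Y x).dist a a'))) ∧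
            HasMajorant (g := toB6 (geo9Y x) 1 (H₀ x)) (blkBK x.toKIdx (bI x))
              (GcoK x.toKIdx bK (bg9YR 𝔸 G (regYP335 𝔸 G) (regYP336 𝔸 G) x) (fun U => U) (T₁ x) U)
              (fun a a' => C * (geo9Y x).len a ^ 2 * Real.exp (-(δ * (geo9Y x).dist a a')))) :
    ∃ M₂ a₂ CG δG : ℝ, 0 < M₂ ∧ 0 < a₂ ∧ 0 ≤ CG ∧ 0 < δG ∧
      ∀ x : MemberY d ℓ hd hL b₀ b₁ Mstar, M₂ ≤ (geo9Y x).M → ∀ α₀ : ℝ, 0 < α₀ → (geo9Y x).M * α₀ ≤ a₂ →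
      ∀ U : (bg9Y 𝔸 G x).Cfg,
        (bg9YP 𝔸 G x).Reg335 c35 α₀ U → (bg9YP 𝔸 G x).Reg336 c35 α₀ U →
          HasMajorant (g := toB6 (geo9Y x) 1 (H₀ x)) (blkBK x.toKIdx (bI x))
            (GcoK x.toKIdx bK (bg9Y 𝔸 G x) (fun U => U) (T₁ x) U)
            (fun a b => CG * (geo9Y x).len a ^ 2 * Real.exp (-(δG * (geo9Y x).dist a b))) := by
  obtain ⟨M₂, a₂, C, δ, hM₂, ha₂, hC, hδ, h⟩ := h
  exact ⟨M₂, a₂, C, δ, hM₂, ha₂, hC, hδ, fun x hM α₀ hα₀ hMa U hU hU' => (h x hM α₀ hα₀ hMa U hU hU').2⟩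

end Shape

/-! ## §2 ★★ By name: `majorants4_of_stepS_R` at print's class ⟹ the door's `hG1fam` shape -/

section ByName

variable {𝔸 : Type} [NormedRing 𝔸] [NormedAlgebra ℂ 𝔸]
variable {κ : Type} [Fintype κ]
variable {d ℓ : ℕ} {hd : 1 ≤ d + 1} {hL : Odd (ℓ + 1) ∧ 1 < ℓ + 1} {b₀ b₁ : ℝ} {Mstar : ℕ}
variable [CompleteSpace 𝔸] [FiniteDimensional ℝ 𝔸] {G : Subgroup 𝔸ˣ}
variable {Y Z W : MemberY d ℓ hd hL b₀ b₁ Mstar → Type} [∀ x, Fintype (Z x)] [∀ x, Fintype (W x)]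

/-- ★★ **THE SOCKET BY NAME**: node N06's state-tuple producer `B9Eq3132FromStateR.majorants4_of_stepS_R`, read at print's class `(regYP335, regYP336)` — its
hypotheses VERBATIM: the walk model `𝔬` over the class-parametric carrier at coordinate pins naming `T`, `T₁`, `T₀` (`hblk hGco hG1co hG0co`), the regular state `𝔖`,
the constants `θS A₀ CR κS δK δP σ δ a₁ M₁` with their signs and the rate budget `δ + 2σ ≤ δ_K`, `δ + σ ≤ δ_P`, `GeoOK`, and the STATE TUPLE `hstate` (step `StepS`,
producer `G₀ : 𝔠⁽⁰⁾ → 𝔖`, reading `𝔖 → 𝔠^{(−2)}`, `κ ≤ κ_S`, ℓ¹-domination, `Identities`) — give the (3.42)₁ sup-entry family of the letter `T₁` in the typing of node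
N08's door binder `hG1fam`: `∃ M₂ a₂ C_G δ_G, …, HasMajorant (blkBK (bI x)) (GcoK … (bg9Y …) (fun U => U) (T₁ x) U) (C_G·(Lʲη)_a²·e^{−δ_G d})` with `δ_G := δ`.
One call and the projection `.2.1`.
[cite: Balaban1985BackgroundPropagators, Thm 3.12 p.423, (3.130) p.421, (3.138) p.423, (3.42) p.397, (3.35)–(3.36) p.396; Balaban1984PropagatorsII, (2.51)–(2.54) pp.232–233, Lemma 2.1 (2.61) p.234] -/
theorem hG1fam_of_majorants4_of_stepS_R [∀ x : MemberY d ℓ hd hL b₀ b₁ Mstar, Fintype (geo9Y x).Site] (bK : Module.Basis κ ℝ 𝔸) {c35 : ℝ}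
    (𝔬 : ∀ x : MemberY d ℓ hd hL b₀ b₁ Mstar, Ops (geo9Y x) (bg9YR 𝔸 G (regYP335 𝔸 G) (regYP336 𝔸 G) x) (XBK κ x.toKIdx) (Y x) (Z x) (W x))
    (H₀ : MemberY d ℓ hd hL b₀ b₁ Mstar → Prop) (T T₁ T₀ : ∀ x : MemberY d ℓ hd hL b₀ b₁ Mstar, BondOpY 𝔸 x.toKIdx)
    {bI : ∀ x : MemberY d ℓ hd hL b₀ b₁ Mstar, FBondY x.toKIdx → IBondY x.toKIdx}
    (hblk : ∀ x, (𝔬 x).blk = blkBK x.toKIdx (bI x))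
    (hGco : ∀ (x : MemberY d ℓ hd hL b₀ b₁ Mstar) (U : (bg9YR 𝔸 G (regYP335 𝔸 G) (regYP336 𝔸 G) x).Cfg),
      (𝔬 x).G U = GcoK x.toKIdx bK (bg9YR 𝔸 G (regYP335 𝔸 G) (regYP336 𝔸 G) x) (fun U => U) (T x) U)
    (hG1co : ∀ (x : MemberY d ℓ hd hL b₀ b₁ Mstar) (U : (bg9YR 𝔸 G (regYP335 𝔸 G) (regYP336 𝔸 G) x).Cfg),
      (𝔬 x).G1 U = GcoK x.toKIdx bK (bg9YR 𝔸 G (regYP335 𝔸 G) (regYP336 𝔸 G) x) (fun U => U) (T₁ x) U)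
    (hG0co : ∀ (x : MemberY d ℓ hd hL b₀ b₁ Mstar) (U : (bg9YR 𝔸 G (regYP335 𝔸 G) (regYP336 𝔸 G) x).Cfg),
      (𝔬 x).G0 U = GcoK x.toKIdx bK (bg9YR 𝔸 G (regYP335 𝔸 G) (regYP336 𝔸 G) x) (fun U => U) (T₀ x) U)
    (𝔖 : ∀ x : MemberY d ℓ hd hL b₀ b₁ Mstar,
      (bg9YR 𝔸 G (regYP335 𝔸 G) (regYP336 𝔸 G) x).Cfg → BlockNorm (toB6 (geo9Y x) 1 (H₀ x)) (XBK κ x.toKIdx → ℝ))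
    (θS A₀ CR κS δK δP σ δ a₁ M₁ : ℝ) (hθS : 0 ≤ θS) (hA₀ : 0 ≤ A₀) (hCR : 0 ≤ CR) (hκS : 0 ≤ κS) (hσ : 0 < σ) (hδ : 0 < δ)
    (hδK : δ + 2 * σ ≤ δK) (hδP : δ + σ ≤ δP) (ha₁ : 0 < a₁) (hM₁ : 0 < M₁) (hgeo : ∀ x : MemberY d ℓ hd hL b₀ b₁ Mstar, GeoOK (geo9Y x))
    (hstate : ∀ x : MemberY d ℓ hd hL b₀ b₁ Mstar, M₁ ≤ (geo9Y x).M → ∀ α₀ : ℝ, 0 < α₀ → (geo9Y x).M * α₀ ≤ a₁ →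
      ∀ U : (bg9YR 𝔸 G (regYP335 𝔸 G) (regYP336 𝔸 G) x).Cfg,
        (bg9YR 𝔸 G (regYP335 𝔸 G) (regYP336 𝔸 G) x).Reg335 c35 α₀ U → (bg9YR 𝔸 G (regYP335 𝔸 G) (regYP336 𝔸 G) x).Reg336 c35 α₀ U →
        StepS (𝔬 x) (𝔖 x U) (θS * ((geo9Y x).M * α₀)) δK U ∧
        HasMaj (cNorm 1 (H₀ x) (𝔬 x).blk (hgeo x).lenle 0) (𝔖 x U) ((𝔬 x).G0 U) (fun a b => A₀ * Real.exp (-(δP * (geo9Y x).dist a b))) ∧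
        HasMaj (𝔖 x U) (cNormR 1 (H₀ x) (𝔬 x).blk (hgeo x).lenle (-2)) LinearMap.id (fun a b => CR * Real.exp (-(δP * (geo9Y x).dist a b))) ∧
        (𝔖 x U).κ ≤ κS ∧ (∃ Λ : ℝ, 0 ≤ Λ ∧ ∀ (y : (geo9Y x).Site) (F : XBK κ x.toKIdx → ℝ), (𝔖 x U).loc y F ≤ Λ * ∑ q : XBK κ x.toKIdx, |F q|) ∧
        Identities (𝔬 x) U) :
    ∃ M₂ a₂ CG δG : ℝ, 0 < M₂ ∧ 0 < a₂ ∧ 0 ≤ CG ∧ 0 < δG ∧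
      ∀ x : MemberY d ℓ hd hL b₀ b₁ Mstar, M₂ ≤ (geo9Y x).M → ∀ α₀ : ℝ, 0 < α₀ → (geo9Y x).M * α₀ ≤ a₂ →
      ∀ U : (bg9Y 𝔸 G x).Cfg,
        (bg9YP 𝔸 G x).Reg335 c35 α₀ U → (bg9YP 𝔸 G x).Reg336 c35 α₀ U →
          HasMajorant (g := toB6 (geo9Y x) 1 (H₀ x)) (blkBK x.toKIdx (bI x))
            (GcoK x.toKIdx bK (bg9Y 𝔸 G x) (fun U => U) (T₁ x) U)
            (fun a b => CG * (geo9Y x).len a ^ 2 * Real.exp (-(δG * (geo9Y x).dist a b))) := by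
  obtain ⟨M₂, a₂, C₁, C₂, hM₂, ha₂, hC₁, -, h⟩ :=
    majorants4_of_stepS_R (regYP335 𝔸 G) (regYP336 𝔸 G) bK 𝔬 H₀ T T₁ T₀ hblk hGco hG1co hG0co 𝔖 θS A₀ CR κS δK δP σ δ a₁ M₁
      hθS hA₀ hCR hκS hσ hδ hδK hδP ha₁ hM₁ hgeo hstate
  exact ⟨M₂, a₂, C₁, δ, hM₂, ha₂, hC₁, hδ, fun x hM α₀ hα₀ hMa U hU hU' => (h x hM α₀ hα₀ hMa U hU hU').2.1⟩

end ByName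

/-! ## §3 ★★ By name AT THE RECORD: the door's `hG1fam` binder character for character -/

section Record

variable {N : ℕ} (θ : Stage3Params) {Mstar : ℕ} (𝔯 : ResY N θ Mstar)
variable {Y Z W : MemberY θ.d₆ θ.ℓ₆ θ.hd' θ.hL' θ.b₀ θ.b₁ Mstar → Type} [∀ x, Fintype (Z x)] [∀ x, Fintype (W x)]

/-- ★★ **THE SOCKET BY NAME AT THE RECORD**: §2 at `𝔸 := Matrix (Fin N) (Fin N) ℂ`, `G := specialUnitaryUnits (Fin N)`, `bK := trBasis N`, `c35 := c35Y`,
`H₀ := Hg`, and the letter `T₁ x := G1Y x.toKIdx (parSymY x.toKIdx) (parBY x.toKIdx) (GpPhysY x.toKIdx (parSymY x.toKIdx)) (𝔯 x).Δ2` of def-Y's record — the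
conclusion is, character for character, the binder `hG1fam` of node N08's socket doors
`B1Eq324BenfattoClassSectEMemberPrecisionDoorRecordV4PAdjCurrentCancelLeaf.eq324_CsDeltaCPstY_lettersYOfRecordV4P_sectEStYOfRecordV7_trBasis_of_b9LeafX_of_G1fam_of_pivotLines_onΛst_on_unit`
(and its `_ofC2` twin): node N06's STATE TUPLE `hstate` at the record ⟹ the door's Theorem 3.12 input for `G₁`, one call.
[cite: Balaban1985BackgroundPropagators, Thm 3.12 p.423, (3.130) p.421, (3.138) p.423, (3.42) p.397, (3.35)–(3.36) p.396; Balaban1984PropagatorsII, (2.51)–(2.54) pp.232–233, Lemma 2.1 (2.61) p.234] -/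
theorem hG1fam_lettersYOfRecordV4P_of_majorants4_of_stepS_R
    [∀ x : MemberY θ.d₆ θ.ℓ₆ θ.hd' θ.hL' θ.b₀ θ.b₁ Mstar, Fintype (geo9Y x).Site]
    (Hg : MemberY θ.d₆ θ.ℓ₆ θ.hd' θ.hL' θ.b₀ θ.b₁ Mstar → Prop)
    (𝔬 : ∀ x : MemberY θ.d₆ θ.ℓ₆ θ.hd' θ.hL' θ.b₀ θ.b₁ Mstar,
      Ops (geo9Y x) (bg9YR (Matrix (Fin N) (Fin N) ℂ) (specialUnitaryUnits (Fin N)) (regYP335 (Matrix (Fin N) (Fin N) ℂ) (specialUnitaryUnits (Fin N)))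
        (regYP336 (Matrix (Fin N) (Fin N) ℂ) (specialUnitaryUnits (Fin N))) x) (XBK (TrIdx N) x.toKIdx) (Y x) (Z x) (W x))
    (T T₀ : ∀ x : MemberY θ.d₆ θ.ℓ₆ θ.hd' θ.hL' θ.b₀ θ.b₁ Mstar, BondOpY (Matrix (Fin N) (Fin N) ℂ) x.toKIdx)
    {bI : ∀ x : MemberY θ.d₆ θ.ℓ₆ θ.hd' θ.hL' θ.b₀ θ.b₁ Mstar, FBondY x.toKIdx → IBondY x.toKIdx}
    (hblk : ∀ x, (𝔬 x).blk = blkBK x.toKIdx (bI x))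
    (hGco : ∀ (x : MemberY θ.d₆ θ.ℓ₆ θ.hd' θ.hL' θ.b₀ θ.b₁ Mstar)
      (U : (bg9YR (Matrix (Fin N) (Fin N) ℂ) (specialUnitaryUnits (Fin N)) (regYP335 (Matrix (Fin N) (Fin N) ℂ) (specialUnitaryUnits (Fin N)))
        (regYP336 (Matrix (Fin N) (Fin N) ℂ) (specialUnitaryUnits (Fin N))) x).Cfg),
      (𝔬 x).G U = GcoK x.toKIdx (trBasis N) (bg9YR (Matrix (Fin N) (Fin N) ℂ) (specialUnitaryUnits (Fin N))
        (regYP335 (Matrix (Fin N) (Fin N) ℂ) (specialUnitaryUnits (Fin N))) (regYP336 (Matrix (Fin N) (Fin N) ℂ) (specialUnitaryUnits (Fin N))) x) (fun U => U) (T x) U)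
    (hG1co : ∀ (x : MemberY θ.d₆ θ.ℓ₆ θ.hd' θ.hL' θ.b₀ θ.b₁ Mstar)
      (U : (bg9YR (Matrix (Fin N) (Fin N) ℂ) (specialUnitaryUnits (Fin N)) (regYP335 (Matrix (Fin N) (Fin N) ℂ) (specialUnitaryUnits (Fin N)))
        (regYP336 (Matrix (Fin N) (Fin N) ℂ) (specialUnitaryUnits (Fin N))) x).Cfg),
      (𝔬 x).G1 U = GcoK x.toKIdx (trBasis N) (bg9YR (Matrix (Fin N) (Fin N) ℂ) (specialUnitaryUnits (Fin N))
        (regYP335 (Matrix (Fin N) (Fin N) ℂ) (specialUnitaryUnits (Fin N))) (regYP336 (Matrix (Fin N) (Fin N) ℂ) (specialUnitaryUnits (Fin N))) x) (fun U => U)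
        (G1Y x.toKIdx (parSymY x.toKIdx) (parBY x.toKIdx) (GpPhysY x.toKIdx (parSymY x.toKIdx)) (𝔯 x).Δ2) U)
    (hG0co : ∀ (x : MemberY θ.d₆ θ.ℓ₆ θ.hd' θ.hL' θ.b₀ θ.b₁ Mstar)
      (U : (bg9YR (Matrix (Fin N) (Fin N) ℂ) (specialUnitaryUnits (Fin N)) (regYP335 (Matrix (Fin N) (Fin N) ℂ) (specialUnitaryUnits (Fin N)))
        (regYP336 (Matrix (Fin N) (Fin N) ℂ) (specialUnitaryUnits (Fin N))) x).Cfg),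
      (𝔬 x).G0 U = GcoK x.toKIdx (trBasis N) (bg9YR (Matrix (Fin N) (Fin N) ℂ) (specialUnitaryUnits (Fin N))
        (regYP335 (Matrix (Fin N) (Fin N) ℂ) (specialUnitaryUnits (Fin N))) (regYP336 (Matrix (Fin N) (Fin N) ℂ) (specialUnitaryUnits (Fin N))) x) (fun U => U) (T₀ x) U)
    (𝔖 : ∀ x : MemberY θ.d₆ θ.ℓ₆ θ.hd' θ.hL' θ.b₀ θ.b₁ Mstar,
      (bg9YR (Matrix (Fin N) (Fin N) ℂ) (specialUnitaryUnits (Fin N)) (regYP335 (Matrix (Fin N) (Fin N) ℂ) (specialUnitaryUnits (Fin N)))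
        (regYP336 (Matrix (Fin N) (Fin N) ℂ) (specialUnitaryUnits (Fin N))) x).Cfg → BlockNorm (toB6 (geo9Y x) 1 (Hg x)) (XBK (TrIdx N) x.toKIdx → ℝ))
    (θS A₀ CR κS δK δP σ δ a₁ M₁ : ℝ) (hθS : 0 ≤ θS) (hA₀ : 0 ≤ A₀) (hCR : 0 ≤ CR) (hκS : 0 ≤ κS) (hσ : 0 < σ) (hδ : 0 < δ)
    (hδK : δ + 2 * σ ≤ δK) (hδP : δ + σ ≤ δP) (ha₁ : 0 < a₁) (hM₁ : 0 < M₁)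
    (hgeo : ∀ x : MemberY θ.d₆ θ.ℓ₆ θ.hd' θ.hL' θ.b₀ θ.b₁ Mstar, GeoOK (geo9Y x))
    (hstate : ∀ x : MemberY θ.d₆ θ.ℓ₆ θ.hd' θ.hL' θ.b₀ θ.b₁ Mstar, M₁ ≤ (geo9Y x).M → ∀ α₀ : ℝ, 0 < α₀ → (geo9Y x).M * α₀ ≤ a₁ →
      ∀ U : (bg9YR (Matrix (Fin N) (Fin N) ℂ) (specialUnitaryUnits (Fin N)) (regYP335 (Matrix (Fin N) (Fin N) ℂ) (specialUnitaryUnits (Fin N)))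
        (regYP336 (Matrix (Fin N) (Fin N) ℂ) (specialUnitaryUnits (Fin N))) x).Cfg,
        (bg9YR (Matrix (Fin N) (Fin N) ℂ) (specialUnitaryUnits (Fin N)) (regYP335 (Matrix (Fin N) (Fin N) ℂ) (specialUnitaryUnits (Fin N)))
          (regYP336 (Matrix (Fin N) (Fin N) ℂ) (specialUnitaryUnits (Fin N))) x).Reg335 c35Y α₀ U →
        (bg9YR (Matrix (Fin N) (Fin N) ℂ) (specialUnitaryUnits (Fin N)) (regYP335 (Matrix (Fin N) (Fin N) ℂ) (specialUnitaryUnits (Fin N)))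
          (regYP336 (Matrix (Fin N) (Fin N) ℂ) (specialUnitaryUnits (Fin N))) x).Reg336 c35Y α₀ U →
        StepS (𝔬 x) (𝔖 x U) (θS * ((geo9Y x).M * α₀)) δK U ∧
        HasMaj (cNorm 1 (Hg x) (𝔬 x).blk (hgeo x).lenle 0) (𝔖 x U) ((𝔬 x).G0 U) (fun a b => A₀ * Real.exp (-(δP * (geo9Y x).dist a b))) ∧
        HasMaj (𝔖 x U) (cNormR 1 (Hg x) (𝔬 x).blk (hgeo x).lenle (-2)) LinearMap.id (fun a b => CR * Real.exp (-(δP * (geo9Y x).dist a b))) ∧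
        (𝔖 x U).κ ≤ κS ∧
        (∃ Λ : ℝ, 0 ≤ Λ ∧ ∀ (y : (geo9Y x).Site) (F : XBK (TrIdx N) x.toKIdx → ℝ), (𝔖 x U).loc y F ≤ Λ * ∑ q : XBK (TrIdx N) x.toKIdx, |F q|) ∧
        Identities (𝔬 x) U) :
    ∃ M₂ a₂ CG δG : ℝ, 0 < M₂ ∧ 0 < a₂ ∧ 0 ≤ CG ∧ 0 < δG ∧
      ∀ x : MemberY θ.d₆ θ.ℓ₆ θ.hd' θ.hL' θ.b₀ θ.b₁ Mstar, M₂ ≤ (geo9Y x).M → ∀ α₀ : ℝ, 0 < α₀ → (geo9Y x).M * α₀ ≤ a₂ →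
      ∀ U : (bg9Y (Matrix (Fin N) (Fin N) ℂ) (specialUnitaryUnits (Fin N)) x).Cfg,
        (bg9YP (Matrix (Fin N) (Fin N) ℂ) (specialUnitaryUnits (Fin N)) x).Reg335 B9PinGeometryKLevelV1.c35Y α₀ U →
        (bg9YP (Matrix (Fin N) (Fin N) ℂ) (specialUnitaryUnits (Fin N)) x).Reg336 B9PinGeometryKLevelV1.c35Y α₀ U →
          HasMajorant (g := toB6 (geo9Y x) 1 (Hg x)) (blkBK x.toKIdx (bI x))
            (GcoK x.toKIdx (trBasis N) (bg9Y (Matrix (Fin N) (Fin N) ℂ) (specialUnitaryUnits (Fin N)) x) (fun U => U)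
              (G1Y x.toKIdx (parSymY x.toKIdx) (parBY x.toKIdx) (GpPhysY x.toKIdx (parSymY x.toKIdx)) (𝔯 x).Δ2) U)
            (fun a b => CG * (geo9Y x).len a ^ 2 * Real.exp (-(δG * (geo9Y x).dist a b))) :=
  hG1fam_of_majorants4_of_stepS_R (trBasis N) 𝔬 Hg T
    (fun x => G1Y x.toKIdx (parSymY x.toKIdx) (parBY x.toKIdx) (GpPhysY x.toKIdx (parSymY x.toKIdx)) (𝔯 x).Δ2) T₀
    hblk hGco hG1co hG0co 𝔖 θS A₀ CR κS δK δP σ δ a₁ M₁ hθS hA₀ hCR hκS hσ hδ hδK hδP ha₁ hM₁ hgeo hstate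

end Record

/-! ## §4–§5 ★★ (v1.1) By name over a CLASS-PARAMETRIC carrier `bg9YR 𝔸 G R₁ R₂` — node N06's closing editions type `𝔬` over GENERIC `(R₁, R₂)` («UD») or
over the constant-blind print families `(regYPb335, regYPb336)` («UE»), member prefix = print's class at `c35Y` under `0 < α₀`: §4 = §2 for any `(R₁, R₂, c)`
reached from print's class by two displayed inclusions `B9LeafXClassAntitone.ClassIncl (regYP335 𝔸 G) c35Y R₁ c` ∕ `… R₂ c`; §5 discharges them at
`(regYPb335, regYPb336)` (`classIncl_regYP33{5,6}_regYPb33{5,6}`); §6 = §5 at the record.  `GcoK … (bg9YR … R₁ R₂ x) … ≡ GcoK … (bg9Y … x) …` is definitional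
for every `(R₁, R₂)` (the `Cfg` field of `bg9YR` is MODULE 2's). -/

section ClassParam

variable {𝔸 : Type} [NormedRing 𝔸] [NormedAlgebra ℂ 𝔸]
variable {κ : Type} [Fintype κ]
variable {d ℓ : ℕ} {hd : 1 ≤ d + 1} {hL : Odd (ℓ + 1) ∧ 1 < ℓ + 1} {b₀ b₁ : ℝ} {Mstar : ℕ}
variable [CompleteSpace 𝔸] [FiniteDimensional ℝ 𝔸] {G : Subgroup 𝔸ˣ}
variable (R₁ R₂ : RegFamY d ℓ hd hL b₀ b₁ Mstar 𝔸)
variable {Y Z W : MemberY d ℓ hd hL b₀ b₁ Mstar → Type} [∀ x, Fintype (Z x)] [∀ x, Fintype (W x)]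

open B9LeafXClassAntitone (ClassIncl) open B9BackgroundsKLevelV1Pb (regYPb335 regYPb336 classIncl_regYP335_regYPb335 classIncl_regYP336_regYPb336)

/-- ★★ **THE SOCKET BY NAME OVER A CLASS-PARAMETRIC CARRIER**: `B9Eq3132FromStateR.majorants4_of_stepS_R (R₁ R₂)` — hypotheses VERBATIM at generic
`(R₁, R₂)` and threshold `c` — plus the two displayed inclusions «print's class (3.35)∕(3.36) at `c35Y` lies in `R₁`∕`R₂` at `c` for `0 < α₀`» give the (3.42)₁
sup-entry family of `T₁` in the typing of node N08's door binder `hG1fam` (prefix `(bg9YP … x).Reg335∕Reg336 c35Y α₀ U`, carrier `bg9Y … x`); one call, the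
inclusions at `(x, α₀, U)`, projection `.2.1`, `δ_G := δ`.
[cite: Balaban1985BackgroundPropagators, Thm 3.12 p.423, (3.130) p.421, (3.138) p.423, (3.42) p.397, (3.35)–(3.36) p.396; Balaban1984PropagatorsII, (2.51)–(2.54) pp.232–233, Lemma 2.1 (2.61) p.234] -/
theorem hG1fam_of_majorants4_of_stepS_R_of_classIncl [∀ x : MemberY d ℓ hd hL b₀ b₁ Mstar, Fintype (geo9Y x).Site] (bK : Module.Basis κ ℝ 𝔸) {c : ℝ}
    (h335 : ClassIncl (regYP335 𝔸 G : RegFamY d ℓ hd hL b₀ b₁ Mstar 𝔸) c35Y R₁ c)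
    (h336 : ClassIncl (regYP336 𝔸 G : RegFamY d ℓ hd hL b₀ b₁ Mstar 𝔸) c35Y R₂ c)
    (𝔬 : ∀ x : MemberY d ℓ hd hL b₀ b₁ Mstar, Ops (geo9Y x) (bg9YR 𝔸 G R₁ R₂ x) (XBK κ x.toKIdx) (Y x) (Z x) (W x))
    (H₀ : MemberY d ℓ hd hL b₀ b₁ Mstar → Prop) (T T₁ T₀ : ∀ x : MemberY d ℓ hd hL b₀ b₁ Mstar, BondOpY 𝔸 x.toKIdx)
    {bI : ∀ x : MemberY d ℓ hd hL b₀ b₁ Mstar, FBondY x.toKIdx → IBondY x.toKIdx}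
    (hblk : ∀ x, (𝔬 x).blk = blkBK x.toKIdx (bI x))
    (hGco : ∀ (x : MemberY d ℓ hd hL b₀ b₁ Mstar) (U : (bg9YR 𝔸 G R₁ R₂ x).Cfg),
      (𝔬 x).G U = GcoK x.toKIdx bK (bg9YR 𝔸 G R₁ R₂ x) (fun U => U) (T x) U)
    (hG1co : ∀ (x : MemberY d ℓ hd hL b₀ b₁ Mstar) (U : (bg9YR 𝔸 G R₁ R₂ x).Cfg),
      (𝔬 x).G1 U = GcoK x.toKIdx bK (bg9YR 𝔸 G R₁ R₂ x) (fun U => U) (T₁ x) U)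
    (hG0co : ∀ (x : MemberY d ℓ hd hL b₀ b₁ Mstar) (U : (bg9YR 𝔸 G R₁ R₂ x).Cfg),
      (𝔬 x).G0 U = GcoK x.toKIdx bK (bg9YR 𝔸 G R₁ R₂ x) (fun U => U) (T₀ x) U)
    (𝔖 : ∀ x : MemberY d ℓ hd hL b₀ b₁ Mstar, (bg9YR 𝔸 G R₁ R₂ x).Cfg → BlockNorm (toB6 (geo9Y x) 1 (H₀ x)) (XBK κ x.toKIdx → ℝ))
    (θS A₀ CR κS δK δP σ δ a₁ M₁ : ℝ) (hθS : 0 ≤ θS) (hA₀ : 0 ≤ A₀) (hCR : 0 ≤ CR) (hκS : 0 ≤ κS) (hσ : 0 < σ) (hδ : 0 < δ)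
    (hδK : δ + 2 * σ ≤ δK) (hδP : δ + σ ≤ δP) (ha₁ : 0 < a₁) (hM₁ : 0 < M₁) (hgeo : ∀ x : MemberY d ℓ hd hL b₀ b₁ Mstar, GeoOK (geo9Y x))
    (hstate : ∀ x : MemberY d ℓ hd hL b₀ b₁ Mstar, M₁ ≤ (geo9Y x).M → ∀ α₀ : ℝ, 0 < α₀ → (geo9Y x).M * α₀ ≤ a₁ →
      ∀ U : (bg9YR 𝔸 G R₁ R₂ x).Cfg, (bg9YR 𝔸 G R₁ R₂ x).Reg335 c α₀ U → (bg9YR 𝔸 G R₁ R₂ x).Reg336 c α₀ U →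
        StepS (𝔬 x) (𝔖 x U) (θS * ((geo9Y x).M * α₀)) δK U ∧
        HasMaj (cNorm 1 (H₀ x) (𝔬 x).blk (hgeo x).lenle 0) (𝔖 x U) ((𝔬 x).G0 U) (fun a b => A₀ * Real.exp (-(δP * (geo9Y x).dist a b))) ∧
        HasMaj (𝔖 x U) (cNormR 1 (H₀ x) (𝔬 x).blk (hgeo x).lenle (-2)) LinearMap.id (fun a b => CR * Real.exp (-(δP * (geo9Y x).dist a b))) ∧
        (𝔖 x U).κ ≤ κS ∧ (∃ Λ : ℝ, 0 ≤ Λ ∧ ∀ (y : (geo9Y x).Site) (F : XBK κ x.toKIdx → ℝ), (𝔖 x U).loc y F ≤ Λ * ∑ q : XBK κ x.toKIdx, |F q|) ∧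
        Identities (𝔬 x) U) :
    ∃ M₂ a₂ CG δG : ℝ, 0 < M₂ ∧ 0 < a₂ ∧ 0 ≤ CG ∧ 0 < δG ∧
      ∀ x : MemberY d ℓ hd hL b₀ b₁ Mstar, M₂ ≤ (geo9Y x).M → ∀ α₀ : ℝ, 0 < α₀ → (geo9Y x).M * α₀ ≤ a₂ →
      ∀ U : (bg9Y 𝔸 G x).Cfg,
        (bg9YP 𝔸 G x).Reg335 c35Y α₀ U → (bg9YP 𝔸 G x).Reg336 c35Y α₀ U →
          HasMajorant (g := toB6 (geo9Y x) 1 (H₀ x)) (blkBK x.toKIdx (bI x))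
            (GcoK x.toKIdx bK (bg9Y 𝔸 G x) (fun U => U) (T₁ x) U)
            (fun a b => CG * (geo9Y x).len a ^ 2 * Real.exp (-(δG * (geo9Y x).dist a b))) := by
  obtain ⟨M₂, a₂, C₁, C₂, hM₂, ha₂, hC₁, -, h⟩ :=
    majorants4_of_stepS_R R₁ R₂ bK 𝔬 H₀ T T₁ T₀ hblk hGco hG1co hG0co 𝔖 θS A₀ CR κS δK δP σ δ a₁ M₁
      hθS hA₀ hCR hκS hσ hδ hδK hδP ha₁ hM₁ hgeo hstate
  exact ⟨M₂, a₂, C₁, δ, hM₂, ha₂, hC₁, hδ, fun x hM α₀ hα₀ hMa U hU hU' =>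
    (h x hM α₀ hα₀ hMa U (h335 x α₀ U hα₀ hU) (h336 x α₀ U hα₀ hU')).2.1⟩

/-- ★★ **THE SOCKET BY NAME AT THE CONSTANT-BLIND PRINT FAMILIES `(regYPb335, regYPb336)`** (node N06's print-literal editions): §4 with both inclusions
DISCHARGED by `classIncl_regYP335_regYPb335 c` ∕ `classIncl_regYP336_regYPb336 c` (every threshold `c`; the stored sign `0 ≤ α₀` from the guard `0 < α₀`).
[cite: Balaban1985BackgroundPropagators, Thm 3.12 p.423, (3.42) p.397, (3.35)–(3.36) p.396 («O(1) … ≧ 10»), Thm 3.1 p.397 («0 < α₀ ≦ α₁»); Balaban1984PropagatorsII, (2.51) p.232] -/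
theorem hG1fam_of_majorants4_of_stepS_Pb [∀ x : MemberY d ℓ hd hL b₀ b₁ Mstar, Fintype (geo9Y x).Site] (bK : Module.Basis κ ℝ 𝔸) {c : ℝ}
    (𝔬 : ∀ x : MemberY d ℓ hd hL b₀ b₁ Mstar, Ops (geo9Y x) (bg9YR 𝔸 G (regYPb335 𝔸 G) (regYPb336 𝔸 G) x) (XBK κ x.toKIdx) (Y x) (Z x) (W x))
    (H₀ : MemberY d ℓ hd hL b₀ b₁ Mstar → Prop) (T T₁ T₀ : ∀ x : MemberY d ℓ hd hL b₀ b₁ Mstar, BondOpY 𝔸 x.toKIdx)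
    {bI : ∀ x : MemberY d ℓ hd hL b₀ b₁ Mstar, FBondY x.toKIdx → IBondY x.toKIdx}
    (hblk : ∀ x, (𝔬 x).blk = blkBK x.toKIdx (bI x))
    (hGco : ∀ (x : MemberY d ℓ hd hL b₀ b₁ Mstar) (U : (bg9YR 𝔸 G (regYPb335 𝔸 G) (regYPb336 𝔸 G) x).Cfg),
      (𝔬 x).G U = GcoK x.toKIdx bK (bg9YR 𝔸 G (regYPb335 𝔸 G) (regYPb336 𝔸 G) x) (fun U => U) (T x) U)
    (hG1co : ∀ (x : MemberY d ℓ hd hL b₀ b₁ Mstar) (U : (bg9YR 𝔸 G (regYPb335 𝔸 G) (regYPb336 𝔸 G) x).Cfg),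
      (𝔬 x).G1 U = GcoK x.toKIdx bK (bg9YR 𝔸 G (regYPb335 𝔸 G) (regYPb336 𝔸 G) x) (fun U => U) (T₁ x) U)
    (hG0co : ∀ (x : MemberY d ℓ hd hL b₀ b₁ Mstar) (U : (bg9YR 𝔸 G (regYPb335 𝔸 G) (regYPb336 𝔸 G) x).Cfg),
      (𝔬 x).G0 U = GcoK x.toKIdx bK (bg9YR 𝔸 G (regYPb335 𝔸 G) (regYPb336 𝔸 G) x) (fun U => U) (T₀ x) U)
    (𝔖 : ∀ x : MemberY d ℓ hd hL b₀ b₁ Mstar,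
      (bg9YR 𝔸 G (regYPb335 𝔸 G) (regYPb336 𝔸 G) x).Cfg → BlockNorm (toB6 (geo9Y x) 1 (H₀ x)) (XBK κ x.toKIdx → ℝ))
    (θS A₀ CR κS δK δP σ δ a₁ M₁ : ℝ) (hθS : 0 ≤ θS) (hA₀ : 0 ≤ A₀) (hCR : 0 ≤ CR) (hκS : 0 ≤ κS) (hσ : 0 < σ) (hδ : 0 < δ)
    (hδK : δ + 2 * σ ≤ δK) (hδP : δ + σ ≤ δP) (ha₁ : 0 < a₁) (hM₁ : 0 < M₁) (hgeo : ∀ x : MemberY d ℓ hd hL b₀ b₁ Mstar, GeoOK (geo9Y x))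
    (hstate : ∀ x : MemberY d ℓ hd hL b₀ b₁ Mstar, M₁ ≤ (geo9Y x).M → ∀ α₀ : ℝ, 0 < α₀ → (geo9Y x).M * α₀ ≤ a₁ →
      ∀ U : (bg9YR 𝔸 G (regYPb335 𝔸 G) (regYPb336 𝔸 G) x).Cfg,
        (bg9YR 𝔸 G (regYPb335 𝔸 G) (regYPb336 𝔸 G) x).Reg335 c α₀ U → (bg9YR 𝔸 G (regYPb335 𝔸 G) (regYPb336 𝔸 G) x).Reg336 c α₀ U →
        StepS (𝔬 x) (𝔖 x U) (θS * ((geo9Y x).M * α₀)) δK U ∧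
        HasMaj (cNorm 1 (H₀ x) (𝔬 x).blk (hgeo x).lenle 0) (𝔖 x U) ((𝔬 x).G0 U) (fun a b => A₀ * Real.exp (-(δP * (geo9Y x).dist a b))) ∧
        HasMaj (𝔖 x U) (cNormR 1 (H₀ x) (𝔬 x).blk (hgeo x).lenle (-2)) LinearMap.id (fun a b => CR * Real.exp (-(δP * (geo9Y x).dist a b))) ∧
        (𝔖 x U).κ ≤ κS ∧ (∃ Λ : ℝ, 0 ≤ Λ ∧ ∀ (y : (geo9Y x).Site) (F : XBK κ x.toKIdx → ℝ), (𝔖 x U).loc y F ≤ Λ * ∑ q : XBK κ x.toKIdx, |F q|) ∧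
        Identities (𝔬 x) U) :
    ∃ M₂ a₂ CG δG : ℝ, 0 < M₂ ∧ 0 < a₂ ∧ 0 ≤ CG ∧ 0 < δG ∧
      ∀ x : MemberY d ℓ hd hL b₀ b₁ Mstar, M₂ ≤ (geo9Y x).M → ∀ α₀ : ℝ, 0 < α₀ → (geo9Y x).M * α₀ ≤ a₂ →
      ∀ U : (bg9Y 𝔸 G x).Cfg,
        (bg9YP 𝔸 G x).Reg335 c35Y α₀ U → (bg9YP 𝔸 G x).Reg336 c35Y α₀ U →
          HasMajorant (g := toB6 (geo9Y x) 1 (H₀ x)) (blkBK x.toKIdx (bI x))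
            (GcoK x.toKIdx bK (bg9Y 𝔸 G x) (fun U => U) (T₁ x) U)
            (fun a b => CG * (geo9Y x).len a ^ 2 * Real.exp (-(δG * (geo9Y x).dist a b))) :=
  hG1fam_of_majorants4_of_stepS_R_of_classIncl (regYPb335 𝔸 G) (regYPb336 𝔸 G) bK
    (classIncl_regYP335_regYPb335 c) (classIncl_regYP336_regYPb336 c)
    𝔬 H₀ T T₁ T₀ hblk hGco hG1co hG0co 𝔖 θS A₀ CR κS δK δP σ δ a₁ M₁ hθS hA₀ hCR hκS hσ hδ hδK hδP ha₁ hM₁ hgeo hstate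

end ClassParam

/-! ## §6 ★★ (v1.1) By name AT THE RECORD over the constant-blind print families (the «UE»-type editions' carrier) -/

section RecordPb

variable {N : ℕ} (θ : Stage3Params) {Mstar : ℕ} (𝔯 : ResY N θ Mstar)
variable {Y Z W : MemberY θ.d₆ θ.ℓ₆ θ.hd' θ.hL' θ.b₀ θ.b₁ Mstar → Type} [∀ x, Fintype (Z x)] [∀ x, Fintype (W x)]

open B9BackgroundsKLevelV1Pb (regYPb335 regYPb336)

/-- ★★ **THE SOCKET BY NAME AT THE RECORD, CONSTANT-BLIND PRINT FAMILIES**: §5 at `Matrix (Fin N) (Fin N) ℂ`, `specialUnitaryUnits (Fin N)`, `trBasis N`,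
`H₀ := Hg`, threshold `c` free (node N06 reads `c := c35B θ.ℓ₆`), `T₁ x := G1Y x.toKIdx (parSymY …) (parBY …) (GpPhysY …) (𝔯 x).Δ2`, everything typed over
`bg9YR … (regYPb335 …) (regYPb336 …) x`; the conclusion is the door binder `hG1fam` character for character (as in §3).
[cite: Balaban1985BackgroundPropagators, Thm 3.12 p.423, (3.130) p.421, (3.138) p.423, (3.42) p.397, (3.35)–(3.36) p.396; Balaban1984PropagatorsII, (2.51)–(2.54) pp.232–233, Lemma 2.1 (2.61) p.234] -/
theorem hG1fam_lettersYOfRecordV4P_of_majorants4_of_stepS_Pb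
    [∀ x : MemberY θ.d₆ θ.ℓ₆ θ.hd' θ.hL' θ.b₀ θ.b₁ Mstar, Fintype (geo9Y x).Site] {c : ℝ}
    (Hg : MemberY θ.d₆ θ.ℓ₆ θ.hd' θ.hL' θ.b₀ θ.b₁ Mstar → Prop)
    (𝔬 : ∀ x : MemberY θ.d₆ θ.ℓ₆ θ.hd' θ.hL' θ.b₀ θ.b₁ Mstar, Ops (geo9Y x) (bg9YR (Matrix (Fin N) (Fin N) ℂ) (specialUnitaryUnits (Fin N)) (regYPb335 (Matrix (Fin N) (Fin N) ℂ) (specialUnitaryUnits (Fin N)))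
        (regYPb336 (Matrix (Fin N) (Fin N) ℂ) (specialUnitaryUnits (Fin N))) x) (XBK (TrIdx N) x.toKIdx) (Y x) (Z x) (W x))
    (T T₀ : ∀ x : MemberY θ.d₆ θ.ℓ₆ θ.hd' θ.hL' θ.b₀ θ.b₁ Mstar, BondOpY (Matrix (Fin N) (Fin N) ℂ) x.toKIdx)
    {bI : ∀ x : MemberY θ.d₆ θ.ℓ₆ θ.hd' θ.hL' θ.b₀ θ.b₁ Mstar, FBondY x.toKIdx → IBondY x.toKIdx}
    (hblk : ∀ x, (𝔬 x).blk = blkBK x.toKIdx (bI x))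
    (hGco : ∀ (x : MemberY θ.d₆ θ.ℓ₆ θ.hd' θ.hL' θ.b₀ θ.b₁ Mstar)
      (U : (bg9YR (Matrix (Fin N) (Fin N) ℂ) (specialUnitaryUnits (Fin N)) (regYPb335 (Matrix (Fin N) (Fin N) ℂ) (specialUnitaryUnits (Fin N))) (regYPb336 (Matrix (Fin N) (Fin N) ℂ) (specialUnitaryUnits (Fin N))) x).Cfg),
      (𝔬 x).G U = GcoK x.toKIdx (trBasis N) (bg9YR (Matrix (Fin N) (Fin N) ℂ) (specialUnitaryUnits (Fin N))
        (regYPb335 (Matrix (Fin N) (Fin N) ℂ) (specialUnitaryUnits (Fin N))) (regYPb336 (Matrix (Fin N) (Fin N) ℂ) (specialUnitaryUnits (Fin N))) x) (fun U => U) (T x) U)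
    (hG1co : ∀ (x : MemberY θ.d₆ θ.ℓ₆ θ.hd' θ.hL' θ.b₀ θ.b₁ Mstar)
      (U : (bg9YR (Matrix (Fin N) (Fin N) ℂ) (specialUnitaryUnits (Fin N)) (regYPb335 (Matrix (Fin N) (Fin N) ℂ) (specialUnitaryUnits (Fin N))) (regYPb336 (Matrix (Fin N) (Fin N) ℂ) (specialUnitaryUnits (Fin N))) x).Cfg),
      (𝔬 x).G1 U = GcoK x.toKIdx (trBasis N) (bg9YR (Matrix (Fin N) (Fin N) ℂ) (specialUnitaryUnits (Fin N))
        (regYPb335 (Matrix (Fin N) (Fin N) ℂ) (specialUnitaryUnits (Fin N))) (regYPb336 (Matrix (Fin N) (Fin N) ℂ) (specialUnitaryUnits (Fin N))) x)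
        (fun U => U) (G1Y x.toKIdx (parSymY x.toKIdx) (parBY x.toKIdx) (GpPhysY x.toKIdx (parSymY x.toKIdx)) (𝔯 x).Δ2) U)
    (hG0co : ∀ (x : MemberY θ.d₆ θ.ℓ₆ θ.hd' θ.hL' θ.b₀ θ.b₁ Mstar)
      (U : (bg9YR (Matrix (Fin N) (Fin N) ℂ) (specialUnitaryUnits (Fin N)) (regYPb335 (Matrix (Fin N) (Fin N) ℂ) (specialUnitaryUnits (Fin N))) (regYPb336 (Matrix (Fin N) (Fin N) ℂ) (specialUnitaryUnits (Fin N))) x).Cfg),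
      (𝔬 x).G0 U = GcoK x.toKIdx (trBasis N) (bg9YR (Matrix (Fin N) (Fin N) ℂ) (specialUnitaryUnits (Fin N))
        (regYPb335 (Matrix (Fin N) (Fin N) ℂ) (specialUnitaryUnits (Fin N))) (regYPb336 (Matrix (Fin N) (Fin N) ℂ) (specialUnitaryUnits (Fin N))) x) (fun U => U) (T₀ x) U)
    (𝔖 : ∀ x : MemberY θ.d₆ θ.ℓ₆ θ.hd' θ.hL' θ.b₀ θ.b₁ Mstar, (bg9YR (Matrix (Fin N) (Fin N) ℂ) (specialUnitaryUnits (Fin N)) (regYPb335 (Matrix (Fin N) (Fin N) ℂ) (specialUnitaryUnits (Fin N)))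
        (regYPb336 (Matrix (Fin N) (Fin N) ℂ) (specialUnitaryUnits (Fin N))) x).Cfg → BlockNorm (toB6 (geo9Y x) 1 (Hg x)) (XBK (TrIdx N) x.toKIdx → ℝ))
    (θS A₀ CR κS δK δP σ δ a₁ M₁ : ℝ) (hθS : 0 ≤ θS) (hA₀ : 0 ≤ A₀) (hCR : 0 ≤ CR) (hκS : 0 ≤ κS) (hσ : 0 < σ) (hδ : 0 < δ)
    (hδK : δ + 2 * σ ≤ δK) (hδP : δ + σ ≤ δP) (ha₁ : 0 < a₁) (hM₁ : 0 < M₁)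
    (hgeo : ∀ x : MemberY θ.d₆ θ.ℓ₆ θ.hd' θ.hL' θ.b₀ θ.b₁ Mstar, GeoOK (geo9Y x))
    (hstate : ∀ x : MemberY θ.d₆ θ.ℓ₆ θ.hd' θ.hL' θ.b₀ θ.b₁ Mstar, M₁ ≤ (geo9Y x).M → ∀ α₀ : ℝ, 0 < α₀ → (geo9Y x).M * α₀ ≤ a₁ →
      ∀ U : (bg9YR (Matrix (Fin N) (Fin N) ℂ) (specialUnitaryUnits (Fin N)) (regYPb335 (Matrix (Fin N) (Fin N) ℂ) (specialUnitaryUnits (Fin N))) (regYPb336 (Matrix (Fin N) (Fin N) ℂ) (specialUnitaryUnits (Fin N))) x).Cfg,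
        (bg9YR (Matrix (Fin N) (Fin N) ℂ) (specialUnitaryUnits (Fin N)) (regYPb335 (Matrix (Fin N) (Fin N) ℂ) (specialUnitaryUnits (Fin N))) (regYPb336 (Matrix (Fin N) (Fin N) ℂ) (specialUnitaryUnits (Fin N))) x).Reg335 c α₀ U →
        (bg9YR (Matrix (Fin N) (Fin N) ℂ) (specialUnitaryUnits (Fin N)) (regYPb335 (Matrix (Fin N) (Fin N) ℂ) (specialUnitaryUnits (Fin N))) (regYPb336 (Matrix (Fin N) (Fin N) ℂ) (specialUnitaryUnits (Fin N))) x).Reg336 c α₀ U →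
        StepS (𝔬 x) (𝔖 x U) (θS * ((geo9Y x).M * α₀)) δK U ∧
        HasMaj (cNorm 1 (Hg x) (𝔬 x).blk (hgeo x).lenle 0) (𝔖 x U) ((𝔬 x).G0 U) (fun a b => A₀ * Real.exp (-(δP * (geo9Y x).dist a b))) ∧
        HasMaj (𝔖 x U) (cNormR 1 (Hg x) (𝔬 x).blk (hgeo x).lenle (-2)) LinearMap.id (fun a b => CR * Real.exp (-(δP * (geo9Y x).dist a b))) ∧
        (𝔖 x U).κ ≤ κS ∧
        (∃ Λ : ℝ, 0 ≤ Λ ∧ ∀ (y : (geo9Y x).Site) (F : XBK (TrIdx N) x.toKIdx → ℝ), (𝔖 x U).loc y F ≤ Λ * ∑ q : XBK (TrIdx N) x.toKIdx, |F q|) ∧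
        Identities (𝔬 x) U) :
    ∃ M₂ a₂ CG δG : ℝ, 0 < M₂ ∧ 0 < a₂ ∧ 0 ≤ CG ∧ 0 < δG ∧
      ∀ x : MemberY θ.d₆ θ.ℓ₆ θ.hd' θ.hL' θ.b₀ θ.b₁ Mstar, M₂ ≤ (geo9Y x).M → ∀ α₀ : ℝ, 0 < α₀ → (geo9Y x).M * α₀ ≤ a₂ →
      ∀ U : (bg9Y (Matrix (Fin N) (Fin N) ℂ) (specialUnitaryUnits (Fin N)) x).Cfg,
        (bg9YP (Matrix (Fin N) (Fin N) ℂ) (specialUnitaryUnits (Fin N)) x).Reg335 B9PinGeometryKLevelV1.c35Y α₀ U →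
        (bg9YP (Matrix (Fin N) (Fin N) ℂ) (specialUnitaryUnits (Fin N)) x).Reg336 B9PinGeometryKLevelV1.c35Y α₀ U →
          HasMajorant (g := toB6 (geo9Y x) 1 (Hg x)) (blkBK x.toKIdx (bI x))
            (GcoK x.toKIdx (trBasis N) (bg9Y (Matrix (Fin N) (Fin N) ℂ) (specialUnitaryUnits (Fin N)) x) (fun U => U)
              (G1Y x.toKIdx (parSymY x.toKIdx) (parBY x.toKIdx) (GpPhysY x.toKIdx (parSymY x.toKIdx)) (𝔯 x).Δ2) U)
            (fun a b => CG * (geo9Y x).len a ^ 2 * Real.exp (-(δG * (geo9Y x).dist a b))) :=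
  hG1fam_of_majorants4_of_stepS_Pb (trBasis N) 𝔬 Hg T
    (fun x => G1Y x.toKIdx (parSymY x.toKIdx) (parBY x.toKIdx) (GpPhysY x.toKIdx (parSymY x.toKIdx)) (𝔯 x).Δ2) T₀
    hblk hGco hG1co hG0co 𝔖 θS A₀ CR κS δK δP σ δ a₁ M₁ hθS hA₀ hCR hκS hσ hδ hδK hδP ha₁ hM₁ hgeo hstate

end RecordPb

end Literature.MathematicalPhysics.QuantumFieldTheory.Balaban1983to89.B9Eq342G1FamilySocketFromStateR
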